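import Summits.ResolutionOfSingularities.ResolutionOfSingularities.Theorems.EquisingularLiftEquisingularLiftNatHypersurfaceLinearCentreBlowup
import Summits.ResolutionOfSingularities.ResolutionOfSingularities.Theorems.EquisingularLiftEquisingularLiftNatSpecimenConeFormsAllN
import Summits.ResolutionOfSingularities.ResolutionOfSingularities.Theorems.EquisingularLiftEquisingularLiftNatSpecimenConeVertexChartAllN
import Summits.ResolutionOfSingularities.ResolutionOfSingularities.Theorems.EquisingularLiftEquisingularLiftNatSpecimenConeNonsingular
import Summits.ResolutionOfSingularities.ResolutionOfSingularities.Theorems.EquisingularLiftEquisingularLiftNatLinearCentrePoints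
import Summits.ResolutionOfSingularities.ResolutionOfSingularities.Theorems.EquisingularLiftEquisingularLiftNatSpecimenConeSingularLocus
import HarnessLib

/-!
# [OURS · L1 W4.5(b)] EL♮ FOR CONES IN EVERY DIMENSION: `Bl_vertex H` is regular and EL♮ holds for the cone
# `H = V₊(G(x₁, …, x_{m+2})) ⊂ ℙ^{m+2}_K` over every prime form `G` with regular affine charts — in particular over every
# nonsingular form (crux `Theses.EquisingularLift.EquisingularLiftNat`, stmt-ResolutionOfSingularities-20038)

NOT a statement of any manuscript; OURS kernel theorem (cell `res-hironaka`, chain w45b; seat res-D-pv-013, own initiative, counted 0). AI-written,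
weaker than expert review. No definition, no `sorry`, standard axioms.

The all-dimension form of `Cone.elNatAt_cone` (p524856, `m = 1`), item 4 («the glue») of the all-n cone plan: the cone-specific inputs of the
generic chart theorem `HypersurfaceSpecimen.isRegular_of_isBlowup_comap_of_charts` and of the rung `elNatAt_of_linearCentreKill`
(…NatHypersurfaceLinearCentreBlowup), with the vertex `[1:0:…:0] = V(x₁,…,x_{m+2})` as the coordinate `ℙ⁰` of the surviving variable `x₀`
(`e : Fin 1 → Fin (m+3)`, `e _ = 0`):

* `ConeN.pos_of_prime_of_isHomogeneous` (any `σ`), `not_mem_range_iff`, `isIntegral_hypersurface_cone`;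
* `ConeN.isRegularRing_chartRing_succ` / `_of_ne_zero` — the chart rings off the vertex (`≅ k[y]/(F(x_{c'+1} := 1))`, …ConeFormsAllN p533811 +
  `HypersurfaceSpecimen.exists_chartQuotEquiv` p532275);
* `ConeN.isRegularRing_blowupAlgebra_tautVec` — the blow-up chart rings over the vertex chart (…ConeVertexChartAllN p532732, transported along
  `ChartRing F 0 ≅ k[y]/(G)`);
* `ConeN.support_subset_range`, `not_range_subset_support` — `V(Λ) ⊆ ι(H)`, `ι(H) ⊄ V(Λ)`;
* **`ConeN.isRegular_of_isBlowup_comap`** — every blow-up of `H` along `Λ·𝒪_H` is regular;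
* **`ConeN.elNatAt_cone`** — `ELNatAt p K (m+2) H ι` for every prime `G ∈ K[T₀,…,T_{m+1}]` with regular affine charts (any `m`);
* **`ConeN.elNatAt_cone_of_isNonsingularForm`** — for every NONSINGULAR form `G` (`m ≥ 1`), via
  `Cone.isRegularRing_quotient_aeval_update_one_of_isNonsingularForm` (p526332) and `IsNonsingularForm.prime`;
  `ConeN.elNatAt_fermatCone` — the Fermat cones `V₊(x₁ᵈ + ⋯ + x_{m+2}ᵈ) ⊂ ℙ^{m+2}`, `p ∤ d`, every `m ≥ 1`;
* `ConeN.not_isRegular_hypersurface_cone`, `not_isRegular_fermatCone` — for `d ≥ 2` these cones are NOT regular (the vertex), so the theorems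
  above are genuine ONE-step instances of EL♮, not instances of the zero-step rung `elNatAt_of_isRegular` (p528875).

References: Hartshorne II Prop. 5.9, I Ex. 5.8; The Stacks Project 0804; Görtz–Wedhorn I 13.96 — through the cited tree files.
-/

set_option linter.dupNamespace false -- mandated namespace `Summit.<Summit>.<Problem>` of this single-conjunct summit

noncomputable section

open CategoryTheory CategoryTheory.Limits AlgebraicGeometry TopologicalSpace
open MvPolynomial HomogeneousLocalization
open Literature.AlgebraicGeometry.Resolution
open Literature.AlgebraicGeometry.Motives Literature.AlgebraicGeometry.Motives.SmoothHypersurface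
open Literature.AlgebraicGeometry.Motives.ProjectiveSpace
open AlgebraicGeometry.Scheme.IdealSheafData
open Summit.ResolutionOfSingularities.ResolutionOfSingularities.Cruxes.EquisingularLift.StrataSplit

namespace Summit.ResolutionOfSingularities.ResolutionOfSingularities.Cruxes.EquisingularLiftNat.Sections

namespace ConeN

variable (k : Type) [Field k] {m : ℕ} (G : MvPolynomial (Fin (m + 2)) k) {d : ℕ} (hG : G.IsHomogeneous d)
  (hF : (rename Fin.succ G : MvPolynomial (Fin (m + 2 + 1)) k).IsHomogeneous d) (hd : 0 < d) (hGp : Prime G)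
  (hreg : ∀ i : Fin (m + 2), IsRegularRing (MvPolynomial (Fin (m + 2)) k ⧸
    Ideal.span {aeval (Function.update (X : Fin (m + 2) → MvPolynomial (Fin (m + 2)) k) i 1) G}))

attribute [local instance] MvPolynomial.gradedAlgebra ProjBaseChange.algebraBase

/-! ## Preliminaries -/

/-- A prime homogeneous form has positive degree (any index type). [folklore] -/
theorem pos_of_prime_of_isHomogeneous {σ : Type*} (P : MvPolynomial σ k) {d : ℕ} (hP : P.IsHomogeneous d) (hPp : Prime P) : 0 < d := by
  by_contra hd
  have hd0 : d = 0 := by omega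
  subst hd0
  have hP' : P = C (P.coeff 0) := by
    rw [P.totalDegree_eq_zero_iff_eq_C.mp ?_]
    · simp
    · have := hP.totalDegree_le
      omega
  by_cases hc : P.coeff 0 = 0
  · exact hPp.ne_zero (by rw [hP', hc, map_zero])
  · exact hPp.not_unit (by rw [hP']; exact (IsUnit.mk0 _ hc).map C)

/-- For the vertex map `e : Fin 1 → Fin (m+3)`, `e _ = 0`: `a ∉ range e ↔ a ≠ 0`. [folklore] -/
theorem not_mem_range_iff {e : Fin 1 → Fin (m + 2 + 1)} (he0 : ∀ j, e j = 0) (a : Fin (m + 2 + 1)) :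
    a ∉ Set.range e ↔ a ≠ 0 := by
  constructor
  · rintro h rfl
    exact h ⟨0, he0 0⟩
  · rintro h ⟨j, rfl⟩
    exact h (he0 j)

include hG hGp in
/-- The cone `V₊(G(x₁,…,x_{m+2}))` is an integral scheme (`F` is prime: `ConeN.prime_rename_succ`). [folklore] -/
theorem isIntegral_hypersurface_cone :
    AlgebraicGeometry.IsIntegral (hypersurface (rename Fin.succ G : MvPolynomial (Fin (m + 2 + 1)) k)).left :=
  HypersurfaceSpecimen.isIntegral_hypersurface_of_prime k _ (isHomogeneous_rename_succ k G hG) (prime_rename_succ k G hGp)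

/-! ## The chart rings off the vertex and the blow-up chart rings over the vertex are regular -/

include hreg in
/-- **The chart rings off the vertex are regular**: `ChartRing F (c'+1) ≅ k[y]/(F(x_{c'+1} := 1))`, a renaming of
`k[T]/(G|_{T_{c'} := 1})` (…ConeFormsAllN). [folklore] -/
theorem isRegularRing_chartRing_succ (c' : Fin (m + 2)) :
    IsRegularRing (ChartRing (rename Fin.succ G : MvPolynomial (Fin (m + 2 + 1)) k) (Fin.succ c') hF) := by
  obtain ⟨θ, -⟩ := HypersurfaceSpecimen.exists_chartQuotEquiv (rename Fin.succ G : MvPolynomial (Fin (m + 2 + 1)) k) hF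
    (Fin.succ c') _ rfl (radical_span_dehomogenize_succ k G c' (hreg c'))
  haveI := isRegularRing_quotient_dehomogenize_succ k G c' (hreg c')
  exact IsRegularRing.of_ringEquiv θ.symm

include hreg in
/-- … the same indexed by `c ≠ 0`. [folklore] -/
theorem isRegularRing_chartRing_of_ne_zero (c : Fin (m + 2 + 1)) (hc : c ≠ 0) :
    IsRegularRing (ChartRing (rename Fin.succ G : MvPolynomial (Fin (m + 2 + 1)) k) c hF) := by
  obtain ⟨c', rfl⟩ := Fin.exists_succ_eq.mpr hc
  exact isRegularRing_chartRing_succ k G hF hreg c'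

include hG hGp hreg in
/-- **The blow-up chart rings over the vertex chart are regular**: for the centre `I = (x_a/x₀ : a ≠ 0)` of `ChartRing F 0` and `b = x_a/x₀`
(`a ≠ 0`), the affine blow-up algebra `(ChartRing F 0)[I/b]` is regular — transported along `ChartRing F 0 ≅ k[y]/(G)` (`x_{j+1}/x₀ ↦ ȳ_j`)
from `ConeN.isRegularRing_vertexChart_of_isHomogeneous` (p532732). [folklore; GW 13.96 (2)] -/
theorem isRegularRing_blowupAlgebra_tautVec {e : Fin 1 → Fin (m + 2 + 1)} (he0 : ∀ j, e j = 0)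
    (a : {a : Fin (m + 2 + 1) // a ∉ Set.range e}) :
    IsRegularRing (blowupAlgebra
      (Ideal.span (Set.range fun a' : {a' : Fin (m + 2 + 1) // a' ∉ Set.range e} =>
        tautVec (rename Fin.succ G : MvPolynomial (Fin (m + 2 + 1)) k) 0 hF a'.1))
      (tautVec (rename Fin.succ G : MvPolynomial (Fin (m + 2 + 1)) k) 0 hF a.1)) := by
  have hrad : (Ideal.span {G}).radical = Ideal.span {G} := ((Ideal.span_singleton_prime hGp.ne_zero).mpr hGp).radical
  obtain ⟨θ, hθ⟩ := HypersurfaceSpecimen.exists_chartQuotEquiv (rename Fin.succ G : MvPolynomial (Fin (m + 2 + 1)) k) hF 0 G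
    (dehomogenize_zero_rename_succ k G) hrad
  simp only [Fin.succAbove_zero] at hθ
  have ha0 : a.1 ≠ 0 := (not_mem_range_iff (m := m) he0 a.1).mp a.2
  obtain ⟨j, hj⟩ : ∃ j : Fin (m + 2), Fin.succ j = a.1 := Fin.exists_succ_eq.mpr ha0
  refine WhitneyCubic.isRegularRing_blowupAlgebra_of_ringEquiv θ _ _ ?_
  have hrange : (⇑θ.toRingHom ∘ fun a' : {a' : Fin (m + 2 + 1) // a' ∉ Set.range e} =>
      tautVec (rename Fin.succ G : MvPolynomial (Fin (m + 2 + 1)) k) 0 hF a'.1) '' Set.univ =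
      (⇑(Ideal.Quotient.mk (Ideal.span {G})) ∘
        (MvPolynomial.X : Fin (m + 2) → MvPolynomial (Fin (m + 2)) k)) '' Set.univ := by
    rw [Set.image_univ, Set.image_univ]
    ext q
    constructor
    · rintro ⟨⟨a', ha'⟩, rfl⟩
      obtain ⟨i, rfl⟩ : ∃ i : Fin (m + 2), Fin.succ i = a' :=
        Fin.exists_succ_eq.mpr ((not_mem_range_iff (m := m) he0 a').mp ha')
      exact ⟨i, (hθ i).symm⟩
    · rintro ⟨i, rfl⟩
      exact ⟨⟨i.succ, (not_mem_range_iff (m := m) he0 _).mpr (Fin.succ_ne_zero i)⟩, hθ i⟩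
  have hI : (Ideal.span (Set.range fun a' : {a' : Fin (m + 2 + 1) // a' ∉ Set.range e} =>
      tautVec (rename Fin.succ G : MvPolynomial (Fin (m + 2 + 1)) k) 0 hF a'.1)).map θ.toRingHom =
      (PointBlowup.originIdeal (m + 1) k).map (Ideal.Quotient.mk (Ideal.span {G})) := by
    change _ = Ideal.map _ (Ideal.span (Set.range MvPolynomial.X))
    rw [Ideal.map_span, Ideal.map_span, ← Set.image_univ, ← Set.image_comp, hrange, Set.image_comp, Set.image_univ]
  rw [hI]
  have hθa : θ (tautVec (rename Fin.succ G : MvPolynomial (Fin (m + 2 + 1)) k) 0 hF a.1) = Ideal.Quotient.mk _ (X j) := by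
    rw [← hj]
    exact hθ j
  erw [hθa]
  exact isRegularRing_vertexChart_of_isHomogeneous k G j hG hGp.ne_zero (hreg j)

/-! ## The vertex `Λ = V₊(x₁, …, x_{m+2})` and the cone -/

section Kill

variable (e : Fin 1 → Fin (m + 2 + 1)) (he0 : ∀ j, e j = 0)
  (fk : homogeneousSubmodule (Fin (m + 2 + 1)) k →+*ᵍ homogeneousSubmodule (Fin (0 + 1)) k)
  (hfk' : HomogeneousIdeal.irrelevant (homogeneousSubmodule (Fin (0 + 1)) k) ≤
    (HomogeneousIdeal.irrelevant (homogeneousSubmodule (Fin (m + 2 + 1)) k)).map fk)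
  (hfkC : ∀ a : k, fk (C a) = C a) (hfke : ∀ j : Fin 1, fk (X (e j)) = X j)
  (hfk0 : ∀ i : Fin (m + 2 + 1), i ∉ Set.range e → fk (X i) = 0)

include he0 hfkC hfke hfk0 hG hd in
/-- **`V(Λ) ⊆ V₊(F) = ι(H)`** (`F = G(x₁,…,x_{m+2}) ∈ (x₁, …, x_{m+2})` for `G` of positive degree): the E1 clause at level `0`. [folklore] -/
theorem support_subset_range :
    ((Proj.map fk hfk').ker.support : Set (Proj (homogeneousSubmodule (Fin (m + 2 + 1)) k))) ⊆
      Set.range (hypersurfaceι (rename Fin.succ G : MvPolynomial (Fin (m + 2 + 1)) k)).left := by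
  intro x hx
  have hX : ∀ j : Fin (m + 2), (X j.succ : MvPolynomial (Fin (m + 2 + 1)) k) ∈ x.asHomogeneousIdeal := fun j =>
    LinearCentre.X_mem_asHomogeneousIdeal_of_mem_support e fk hfk' hfkC hfke hfk0 hx
      ((not_mem_range_iff (m := m) he0 _).mpr (Fin.succ_ne_zero j))
  refine (Set.ext_iff.mp (range_hypersurfaceι (rename Fin.succ G : MvPolynomial (Fin (m + 2 + 1)) k)) x).mpr
    ((ProjectiveSpectrum.mem_zeroLocus _ _ _).mpr (Set.singleton_subset_iff.mpr ?_))
  change (rename Fin.succ G : MvPolynomial (Fin (m + 2 + 1)) k) ∈ x.asHomogeneousIdeal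
  exact (Ideal.span_le.mpr (Set.range_subset_iff.mpr hX)) (rename_succ_mem_span_X_succ k G hG hd)

include he0 hfkC hfke hfk0 hF hGp in
/-- **`ι(H) ⊄ V(Λ)`**: the generic point `(F)` of `H` misses some `V₊(x_{a+1})` (`ConeN.exists_X_succ_not_mem_span`). [folklore] -/
theorem not_range_subset_support :
    ¬ (Set.range (hypersurfaceι (rename Fin.succ G : MvPolynomial (Fin (m + 2 + 1)) k)).left ⊆
      ((Proj.map fk hfk').ker.support : Set (Proj (homogeneousSubmodule (Fin (m + 2 + 1)) k)))) := by
  intro h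
  have hmem : (pointOfPrime (rename Fin.succ G : MvPolynomial (Fin (m + 2 + 1)) k) hF (prime_rename_succ k G hGp) :
      Proj (homogeneousSubmodule (Fin (m + 2 + 1)) k)) ∈
        Set.range (hypersurfaceι (rename Fin.succ G : MvPolynomial (Fin (m + 2 + 1)) k)).left := by
    refine (Set.ext_iff.mp (range_hypersurfaceι (rename Fin.succ G : MvPolynomial (Fin (m + 2 + 1)) k)) _).mpr
      ((ProjectiveSpectrum.mem_zeroLocus _ _ _).mpr (Set.singleton_subset_iff.mpr ?_))
    exact Ideal.subset_span rfl
  obtain ⟨a, ha⟩ := exists_X_succ_not_mem_span k G hGp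
  exact ha (LinearCentre.X_mem_asHomogeneousIdeal_of_mem_support e fk hfk' hfkC hfke hfk0 (h hmem)
    ((not_mem_range_iff (m := m) he0 _).mpr (Fin.succ_ne_zero a)))

/-! ## Every blow-up of `H` along `Λ·𝒪_H` is regular -/

include he0 hfkC hfke hfk0 hG hF hd hGp hreg in
/-- **`Bl_vertex H` IS REGULAR, for every blow-up** (any `m`): every blow-up `ρ : Z → H` of the cone along the trace `Λ·𝒪_H` of the vertex
`Λ = V₊(x₁,…,x_{m+2})` is a regular scheme — `HypersurfaceSpecimen.isRegular_of_isBlowup_comap_of_charts` with the chart rings off the vertex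
(`isRegularRing_chartRing_of_ne_zero`) and the blow-up chart rings over the vertex chart (`isRegularRing_blowupAlgebra_tautVec`).
[cite: StacksProject, Tag 0804] -/
theorem isRegular_of_isBlowup_comap (Z : Scheme.{0}) (ρ : Z ⟶ (hypersurface (rename Fin.succ G : MvPolynomial (Fin (m + 2 + 1)) k)).left)
    (hρ : IsBlowup ρ (((Proj.map fk hfk').ker.comap (hypersurfaceι (rename Fin.succ G : MvPolynomial (Fin (m + 2 + 1)) k)).left))) :
    Scheme.IsRegular Z := by
  have he : Function.Injective e := Function.injective_of_subsingleton e
  refine HypersurfaceSpecimen.isRegular_of_isBlowup_comap_of_charts k (rename Fin.succ G : MvPolynomial (Fin (m + 2 + 1)) k) hF hd e he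
    fk hfk' hfkC hfke hfk0 (fun c hc => ?_) (fun c hc a => ?_) Z ρ hρ
  · exact isRegularRing_chartRing_of_ne_zero k G hF hreg c ((not_mem_range_iff (m := m) he0 c).mp hc)
  · obtain ⟨j, rfl⟩ := hc
    rw [he0 j]
    exact isRegularRing_blowupAlgebra_tautVec k G hG hF hGp hreg he0 a

end Kill

/-! ## EL♮ for cones in every dimension -/

/-- **EL♮ HOLDS FOR THE CONE OVER EVERY SMOOTH HYPERSURFACE, IN EVERY DIMENSION**: for `G ∈ K[T₀,…,T_{m+1}]` prime and homogeneous whose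
`m + 2` affine charts `K[T]/(G|_{Tᵢ := 1})` are regular rings, the cone `H = V₊(G(x₁,…,x_{m+2})) ⊂ ℙ^{m+2}_K` (`K` algebraically closed of
characteristic `p`) satisfies `Theorems.EquisingularLift.ELNatAt p K (m+2) H ι` (p503491). Witnesses: `O = 𝕎(K)`, ONE blow-up of `ℙ^{m+2}_O`
along the `O`-point `V(x₁,…,x_{m+2})` = the section through the vertex (`elNatAt_of_linearCentreKill`, `e _ = 0`); downstairs every blow-up of
`H` along `Λ·𝒪_H` is regular (`isRegular_of_isBlowup_comap`). The case `m = 1` is `Cone.elNatAt_cone` (p524856). [OURS · L1 W4.5b] [folklore] -/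
theorem elNatAt_cone (p : ℕ) (hp : p.Prime) (K : Type) [Field K] [CharP K p] [IsAlgClosed K] {m : ℕ}
    (G : MvPolynomial (Fin (m + 2)) K) {d : ℕ} (hG : G.IsHomogeneous d) (hGp : Prime G)
    (hreg : ∀ i : Fin (m + 2), IsRegularRing (MvPolynomial (Fin (m + 2)) K ⧸
      Ideal.span {aeval (Function.update (X : Fin (m + 2) → MvPolynomial (Fin (m + 2)) K) i 1) G})) :
    Theorems.EquisingularLift.ELNatAt p K (m + 2) (hypersurface (rename Fin.succ G : MvPolynomial (Fin (m + 2 + 1)) K)).left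
      (hypersurfaceι (rename Fin.succ G : MvPolynomial (Fin (m + 2 + 1)) K)).left := by
  classical
  have hF : (rename Fin.succ G : MvPolynomial (Fin (m + 2 + 1)) K).IsHomogeneous d := isHomogeneous_rename_succ K G hG
  have hd : 0 < d := pos_of_prime_of_isHomogeneous K G hG hGp
  let e : Fin 1 → Fin (m + 2 + 1) := fun _ => 0
  have he0 : ∀ j, e j = 0 := fun _ => rfl
  have he : Function.Injective e := Function.injective_of_subsingleton e
  obtain ⟨fk, hfk', hfkC, hfke, hfk0⟩ := LinearCentre.exists_kill (R := K) e he
  haveI := isIntegral_hypersurface_cone K G hG hGp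
  exact elNatAt_of_linearCentreKill p hp K e he _ (hypersurfaceι (rename Fin.succ G : MvPolynomial (Fin (m + 2 + 1)) K)).left
    fk hfk' hfkC hfke hfk0 (support_subset_range K G hG hd e he0 fk hfk' hfkC hfke hfk0)
    (not_range_subset_support K G hF hGp e he0 fk hfk' hfkC hfke hfk0)
    (fun Z ρ hρ => isRegular_of_isBlowup_comap K G hG hF hd hGp hreg e he0 fk hfk' hfkC hfke hfk0 Z ρ hρ)

/-- **EL♮ HOLDS FOR THE CONE OVER EVERY NONSINGULAR FORM, IN EVERY DIMENSION** (`m ≥ 1`): for a nonsingular form `G ∈ K[T₀,…,T_{m+1}]` of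
degree `d ≥ 1` (`IsNonsingularForm`: prime by `IsNonsingularForm.prime`, regular idle-variable charts by
`Cone.isRegularRing_quotient_aeval_update_one_of_isNonsingularForm` p526332) the cone `V₊(G(x₁,…,x_{m+2})) ⊂ ℙ^{m+2}_K` — an isolated
singularity of multiplicity `d` at the vertex for `d ≥ 2` — satisfies `ELNatAt p K (m+2)`. [OURS · L1 W4.5b] [folklore] -/
theorem elNatAt_cone_of_isNonsingularForm (p : ℕ) (hp : p.Prime) (K : Type) [Field K] [CharP K p] [IsAlgClosed K] {m : ℕ} (hm : 1 ≤ m)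
    (G : MvPolynomial (Fin (m + 2)) K) {d : ℕ} (hG : G.IsHomogeneous d) (hd : 1 ≤ d) (hns : IsNonsingularForm K G) :
    Theorems.EquisingularLift.ELNatAt p K (m + 2) (hypersurface (rename Fin.succ G : MvPolynomial (Fin (m + 2 + 1)) K)).left
      (hypersurfaceι (rename Fin.succ G : MvPolynomial (Fin (m + 2 + 1)) K)).left :=
  elNatAt_cone p hp K G hG (hns.prime hm hd hG) (Cone.isRegularRing_quotient_aeval_update_one_of_isNonsingularForm K G hG hns)

/-- **Instance: the Fermat cones in every dimension** `V₊(x₁ᵈ + ⋯ + x_{m+2}ᵈ) ⊂ ℙ^{m+2}_K`, `p ∤ d`, `m ≥ 1` (tree `isNonsingularForm_sum_X_pow`);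
`m = 1` is `FermatCone.elNatAt_fermatCone` (p518711). [OURS · L1 W4.5b] [folklore] -/
theorem elNatAt_fermatCone (d p : ℕ) (hp : p.Prime) (K : Type) [Field K] [CharP K p] [IsAlgClosed K] {m : ℕ} (hm : 1 ≤ m)
    (hdK : (d : K) ≠ 0) :
    Theorems.EquisingularLift.ELNatAt p K (m + 2)
      (hypersurface (rename Fin.succ (∑ i : Fin (m + 2), (X i : MvPolynomial (Fin (m + 2)) K) ^ d) :
        MvPolynomial (Fin (m + 2 + 1)) K)).left
      (hypersurfaceι (rename Fin.succ (∑ i : Fin (m + 2), (X i : MvPolynomial (Fin (m + 2)) K) ^ d) :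
        MvPolynomial (Fin (m + 2 + 1)) K)).left := by
  have hd : 1 ≤ d := Nat.one_le_iff_ne_zero.mpr (by rintro rfl; exact hdK (by simp))
  have hG : (∑ i : Fin (m + 2), (X i : MvPolynomial (Fin (m + 2)) K) ^ d).IsHomogeneous d :=
    IsHomogeneous.sum _ _ _ fun i _ => by simpa using (isHomogeneous_X K i).pow d
  exact elNatAt_cone_of_isNonsingularForm p hp K hm _ hG hd (isNonsingularForm_sum_X_pow (n := m) hdK)

/-! ## The cones are singular: genuine one-step instances -/

/-- **THE CONES ARE NOT REGULAR SCHEMES** (any `m`): for a prime form `G ∈ K[T₀,…,T_{m+1}]` of degree `d ≥ 2` the cone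
`H = V₊(G(x₁,…,x_{m+2})) ⊂ ℙ^{m+2}_K` is not regular — its vertex chart `Spec (ChartRing F 0) ≅ Spec K[y]/(G)`
(`HypersurfaceSpecimen.exists_chartQuotEquiv`) is an open subscheme and `(K[y]/(G))_{𝔪₀}` is not regular since `G(0) = 0`, `∇G(0) = 0`
(tree `Resolution.not_isRegularLocalRing_localization_of_pderiv_eval_eq_zero`). The case `m = 1` is `Cone.not_isRegular_hypersurface_cone`
(p530647). [cite: Hartshorne1977, I Thm. 5.1] -/
theorem not_isRegular_hypersurface_cone (K : Type) [Field K] {m : ℕ} (G : MvPolynomial (Fin (m + 2)) K) {d : ℕ} (hG : G.IsHomogeneous d)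
    (hd : 2 ≤ d) (hGp : Prime G) :
    ¬ Scheme.IsRegular (hypersurface (rename Fin.succ G : MvPolynomial (Fin (m + 2 + 1)) K)).left := by
  intro hreg
  have hF : (rename Fin.succ G : MvPolynomial (Fin (m + 2 + 1)) K).IsHomogeneous d := isHomogeneous_rename_succ K G hG
  have hd0 : 0 < d := by omega
  have hrad : (Ideal.span {G}).radical = Ideal.span {G} := ((Ideal.span_singleton_prime hGp.ne_zero).mpr hGp).radical
  obtain ⟨θ, -⟩ := HypersurfaceSpecimen.exists_chartQuotEquiv (rename Fin.succ G : MvPolynomial (Fin (m + 2 + 1)) K) hF 0 G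
    (dehomogenize_zero_rename_succ K G) hrad
  -- the vertex chart is an open subscheme of `H`, hence regular, hence its (Noetherian) coordinate ring is a regular ring
  have h1 : Scheme.IsRegular (Spec (CommRingCat.of (ChartRing (rename Fin.succ G : MvPolynomial (Fin (m + 2 + 1)) K) 0 hF))) :=
    @Scheme.IsRegular.of_isOpenImmersion _ _ (chart (rename Fin.succ G : MvPolynomial (Fin (m + 2 + 1)) K) 0 hF hd0).left
      (isOpenImmersion_chart_left (rename Fin.succ G : MvPolynomial (Fin (m + 2 + 1)) K) 0 hF hd0) hreg
  have hN : IsNoetherianRing (ChartRing (rename Fin.succ G : MvPolynomial (Fin (m + 2 + 1)) K) 0 hF) :=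
    isNoetherianRing_of_ringEquiv (MvPolynomial (Fin (m + 2)) K ⧸ Ideal.span {G}) θ.symm
  have h2 : IsRegularRing (ChartRing (rename Fin.succ G : MvPolynomial (Fin (m + 2 + 1)) K) 0 hF) :=
    (@Scheme.isRegular_Spec_iff (CommRingCat.of (ChartRing (rename Fin.succ G : MvPolynomial (Fin (m + 2 + 1)) K) 0 hF)) hN).mp h1
  haveI : IsRegularRing (MvPolynomial (Fin (m + 2)) K ⧸ Ideal.span {G}) := IsRegularRing.of_ringEquiv θ
  -- the vertex `𝔪₀/(G)` of `K[y]/(G)` is a non-regular point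
  have h0 : eval (0 : Fin (m + 2) → K) G = 0 := Cone.eval_zero_of_isHomogeneous K G hG (by omega)
  have hle : Ideal.span {G} ≤ RingHom.ker (eval (0 : Fin (m + 2) → K)) :=
    (Ideal.span_singleton_le_iff_mem _).mpr ((RingHom.mem_ker).mpr h0)
  haveI h𝔫 : (RingHom.ker (eval (0 : Fin (m + 2) → K)) : Ideal (MvPolynomial (Fin (m + 2)) K)).IsMaximal :=
    RingHom.ker_isMaximal_of_surjective (eval (0 : Fin (m + 2) → K)) fun x => ⟨C x, eval_C x⟩
  set P : Ideal (MvPolynomial (Fin (m + 2)) K ⧸ Ideal.span {G}) :=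
    (RingHom.ker (eval (0 : Fin (m + 2) → K))).map (Ideal.Quotient.mk (Ideal.span {G})) with hP
  have hPcomap : P.comap (Ideal.Quotient.mk (Ideal.span {G})) = RingHom.ker (eval (0 : Fin (m + 2) → K)) := by
    rw [hP, Ideal.comap_map_of_surjective _ Ideal.Quotient.mk_surjective, ← RingHom.ker_eq_comap_bot, Ideal.mk_ker,
      sup_eq_left.mpr hle]
  haveI hPmax : P.IsMaximal := by
    refine (Ideal.map_eq_top_or_isMaximal_of_surjective _ Ideal.Quotient.mk_surjective h𝔫).resolve_left fun htop => ?_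
    have h := hPcomap
    rw [hP, htop, Ideal.comap_top] at h
    exact h𝔫.ne_top h.symm
  exact not_isRegularLocalRing_localization_of_pderiv_eval_eq_zero (0 : Fin (m + 2) → K) hGp.ne_zero h0
    (Cone.eval_zero_pderiv_of_isHomogeneous K G hG hd) P hPcomap (IsRegularRing.isRegularLocalRing_localization P)

/-- **The Fermat cones `x₁ᵈ + ⋯ + x_{m+2}ᵈ = 0`, `d ≥ 2`, `p ∤ d`, `m ≥ 1`, are not regular.** [folklore] -/
theorem not_isRegular_fermatCone (K : Type) [Field K] {m : ℕ} (hm : 1 ≤ m) (d : ℕ) (hd : 2 ≤ d) (hdK : (d : K) ≠ 0) :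
    ¬ Scheme.IsRegular (hypersurface (rename Fin.succ (∑ i : Fin (m + 2), (X i : MvPolynomial (Fin (m + 2)) K) ^ d) :
      MvPolynomial (Fin (m + 2 + 1)) K)).left := by
  have hG : (∑ i : Fin (m + 2), (X i : MvPolynomial (Fin (m + 2)) K) ^ d).IsHomogeneous d :=
    IsHomogeneous.sum _ _ _ fun i _ => by simpa using (isHomogeneous_X K i).pow d
  exact not_isRegular_hypersurface_cone K _ hG hd ((isNonsingularForm_sum_X_pow (n := m) hdK).prime hm (by omega) hG)

end ConeN

end Summit.ResolutionOfSingularities.ResolutionOfSingularities.Cruxes.EquisingularLiftNat.Sections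

end
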